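import Literature.MathematicalPhysics.KineticTheory.PureQuarticEnergy
import Literature.MathematicalPhysics.KineticTheory.LangevinChainConfinedLaSalle
import Literature.MathematicalPhysics.KineticTheory.LangevinChainExpBound
import Literature.MathematicalPhysics.KineticTheory.LangevinChainLimitFlow
import HarnessLib

/-!
# The purely quartic chain has confining potentials: its Langevin transition semigroup, (3.4), LaSalle

Topic `Literature/MathematicalPhysics/KineticTheory` (trunk T-KINETIC). First proof file of the
provefact unit for the named fact `CuneoEckmannHairerReyBellet2018_thm213_pureQuartic`
(`PureQuarticChainNESS.lean`): Cuneo–Eckmann–Hairer–Rey-Bellet, *Non-equilibrium steady states for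
networks of oscillators*, Electron. J. Probab. **23** (2018) no. 55 (arXiv:1712.09413), Theorem 2.13
(1)–(3) for the purely quartic chain `pureQuarticChain μ γ = ⟨U = μq⁴/4, V = r⁴/4, γ⟩`
(`QuarticRingChain.lean`), `μ, γ > 0`.

The printed proof is Theorem 3.1 (Props. 3.2, 3.3, 3.6, 3.7, 3.8) with H1 (Prop. 4.1) and H2
(Thm 5.1 / Rem. 5.2). The tree proves all of it for `pinnedChain ω₂ lam β γ`
(`LangevinSemigroupProofs.lean`), but through an older, model-specific pipeline and with two
inputs that use the HARMONIC parts of the pinned chain (Kalman's condition at the equilibrium for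
the local minorisation; `V'' ≠ 0` for the brackets), which the purely quartic chain does not have
(`U''(0) = V''(0) = 0`). This file puts the purely quartic chain on the MODEL-FREE pipeline
(`ConfinedForcedFlow.lean` → … → `LangevinChainConfined.lean`, `LangevinChainConfinedLaSalle.lean`)
and records what that pipeline gives for free (the elementary energy layer — linear energy bound,
coercivity, compact sublevel sets — is `PureQuarticEnergy.lean`); everything is PROVED, no
definition and no named fact is introduced:

* `pureQuarticChain_isConfining` — `U, V ∈ C²`, `U, V ≥ 0`, `|U'| ≤ (μ+4)(1+U)`, `|V'| ≤ 4(1+V)`,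
  `U → ∞`: the hypothesis structure `OscillatorChain.IsConfining`;
* the transition semigroup `(pureQuarticChain_isConfining hμ hγ).semigroup N T_L T_R hN hTL hTR`
  (CEHR (2.3), p. 10) of the SDE (2.2) for this chain, a `LangevinChainSemigroup` (Markov,
  `P_0 = id`, Chapman–Kolmogorov, measurable, Dynkin on `C_c^∞`) whose kernels are
  `OscillatorChain.langevinKernel`, with the Feller property
  (`pureQuarticChain_continuous_act_semigroup`, CEHR p. 9 "the process is Feller") and CEHR (3.4)
  `P^t e^{θH} ≤ e^{θγ(T_L+T_R)t} e^{θH}` (`pureQuarticChain_lintegral_exp_mul_hamiltonian_kernel_le`,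
  from the generic `LangevinChainSemigroup.lintegral_exp_mul_hamiltonian_le` of
  `LangevinChainExpBound.lean`);
* the virial rigidity `∂Φ = 0 ⟹ q = 0` and the injectivity of `V' = r³`, hence
  — by the generic LaSalle principle `OscillatorChain.IsConfining.tendsto_freeFlow_zero` — the
  relaxation of the undriven damped chain to `0` and the pointed irreducibility of the transition
  kernels towards `0` (CEHR Prop. 3.3 for this chain, `pureQuarticChain_langevinKernel_pos_of_mem_nhds_zero`);
* `pureQuarticChain_hamiltonian_eq_limitChain` — the Hamiltonian of the purely quartic chain IS the
  limit Hamiltonian `Ĥ` of CEHR §5.1 (5.9) with `lam = μ`, `β = 1` (`limitChain μ 1` of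
  `LangevinChainLimitFlow.lean`: the chain is exactly homogeneous, it is its own scaling limit), so
  the deterministic core of Prop. 5.3 (`exists_le_limitDissipation`) applies to it verbatim.

## References

* N. Cuneo, J.-P. Eckmann, M. Hairer, L. Rey-Bellet, EJP **23** (2018) no. 55 (arXiv:1712.09413):
  eq. (2.2)–(2.3), §3 p. 7 and eq. (3.4), Prop. 3.3, §5.1 eq. (5.9). Page numbers refer to the
  arXiv version.
* R. Khasminskii, *Stochastic Stability of Differential Equations* (2nd ed., 2012), Thm 3.5.
-/

noncomputable section

open MeasureTheory ProbabilityTheory Filter Topology Set Metric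
open scoped NNReal ENNReal ContDiff

namespace Literature.MathematicalPhysics.KineticTheory.HeatConduction

open OscillatorChain Literature.MathematicalPhysics.KineticTheory Literature.Probability.Process

variable {N : ℕ}

/-! ### The purely quartic chain has confining potentials -/

/-- `U(q) = μq⁴/4 → ∞` as `|q| → ∞` (`μ > 0`). [folklore] -/
theorem pureQuarticChain_tendsto_U {μ : ℝ} (hμ : 0 < μ) (γ : ℝ) :
    Tendsto (pureQuarticChain μ γ).U (cocompact ℝ) atTop := by
  have hU : (pureQuarticChain μ γ).U = fun x => ‖x‖ ^ 4 * (μ / 4) := by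
    funext x
    simp only [pureQuarticChain_U, Real.norm_eq_abs]
    have : x ^ 4 = |x| ^ 4 := by rw [pow_abs, abs_of_nonneg (by positivity : (0:ℝ) ≤ x ^ 4)]
    rw [this]
    ring
  rw [hU]
  exact ((tendsto_pow_atTop (by norm_num : (4:ℕ) ≠ 0)).comp tendsto_norm_cocompact_atTop).atTop_mul_const
    (by positivity)

/-- **The purely quartic chain satisfies `OscillatorChain.IsConfining`** (`μ > 0`, `γ ≥ 0`):
`U, V` smooth and nonnegative, `|U'(q)| = μ|q|³ ≤ (μ + 4)(1 + U(q))`, `|V'(r)| = |r|³ ≤ 4(1 + V(r))`,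
`U(q) → ∞`. [cite: CuneoEckmannHairerReyBellet2018, §2.3 Example 2.8] -/
theorem pureQuarticChain_isConfining {μ : ℝ} (hμ : 0 < μ) {γ : ℝ} (hγ : 0 ≤ γ) :
    (pureQuarticChain μ γ).IsConfining where
  contDiff_U := pureQuarticChain_contDiff_U μ γ
  contDiff_V := pureQuarticChain_contDiff_V μ γ
  γ_nonneg := hγ
  U_nonneg := pureQuarticChain_U_nonneg hμ.le γ
  V_nonneg := pureQuarticChain_V_nonneg μ γ
  exists_abs_deriv_U_le := by
    refine ⟨μ + 4, by positivity, fun q => ?_⟩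
    rw [pureQuarticChain_deriv_U, pureQuarticChain_U, abs_mul, abs_of_pos hμ, abs_pow]
    have h1 := abs_pow_three_le_one_add_pow_four q
    have h2 : 0 ≤ q ^ 4 := by positivity
    nlinarith [mul_nonneg hμ.le h2, mul_nonneg (mul_nonneg hμ.le hμ.le) h2]
  exists_abs_deriv_V_le := by
    refine ⟨4, by norm_num, fun r => ?_⟩
    rw [pureQuarticChain_deriv_V, pureQuarticChain_V, abs_pow]
    have h1 := abs_pow_three_le_one_add_pow_four r
    linarith
  tendsto_U := pureQuarticChain_tendsto_U hμ γ

/-! ### The limit Hamiltonian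

Compact sublevel sets of `H` and of `e^{θH}` and the continuity of `H` are in `PureQuarticEnergy.lean`
(`pureQuarticChain_isCompact_setOf_hamiltonian_le`, `pureQuarticChain_isCompact_setOf_exp_le`,
`pureQuarticChain_continuous_hamiltonian`). -/

/-- **The purely quartic chain is its own scaling limit**: its Hamiltonian is the limit
Hamiltonian `Ĥ` of CEHR §5.1 (5.9) with quartic pinning coefficient `lam = μ` and quartic coupling
coefficient `β = 1` (`limitChain μ 1`; the friction constants differ, the Hamiltonians do not depend
on them). [cite: CuneoEckmannHairerReyBellet2018, §5.1 eq. (5.9)] -/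
theorem pureQuarticChain_hamiltonian_eq_limitChain (μ γ : ℝ) (N : ℕ) :
    (pureQuarticChain μ γ).hamiltonian N = (limitChain μ 1).hamiltonian N := by
  funext x
  simp only [OscillatorChain.hamiltonian, pureQuarticChain_U, pureQuarticChain_V, limitChain, one_mul]

/-- The forces agree as well: `∂_iΦ` of the purely quartic chain is that of `limitChain μ 1`.
[folklore] -/
theorem pureQuarticChain_dPotential_eq_limitChain (μ γ : ℝ) (N : ℕ) :
    (pureQuarticChain μ γ).dPotential N = (limitChain μ 1).dPotential N := by
  funext i q
  simp only [OscillatorChain.dPotential, pureQuarticChain_deriv_U, pureQuarticChain_deriv_V,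
    limitChain_deriv_U, limitChain_deriv_V, one_mul]

/-- Closed form of the force of the purely quartic chain:
`∂_iΦ(q) = μq_i³ + (q_i - q_{i-1})³ - (q_{i+1} - q_i)³` (boundary terms absent at the ends).
[folklore] -/
theorem pureQuarticChain_dPotential_apply (μ γ : ℝ) (N : ℕ) (i : Fin N) (q : Fin N → ℝ) :
    (pureQuarticChain μ γ).dPotential N i q = μ * q i ^ 3 +
      (if h : 0 < i.val then (q i - q ⟨i.val - 1, by omega⟩) ^ 3 else 0) -
      (if h : i.val + 1 < N then (q ⟨i.val + 1, h⟩ - q i) ^ 3 else 0) := by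
  rw [(pureQuarticChain μ γ).dPotential_eq_closed N i q, pureQuarticChain_deriv_U]
  simp only [pureQuarticChain_deriv_V]

/-! ### Rigidity of the potential: `V'` injective, the origin is the only critical point -/

/-- `V' = r ↦ r³` is injective (Condition C4; odd strictly monotone). [cite: CuneoEckmannHairerReyBellet2018, Remark 2.10] -/
theorem pureQuarticChain_deriv_V_injective (μ γ : ℝ) :
    Function.Injective (deriv (pureQuarticChain μ γ).V) := by
  have h : deriv (pureQuarticChain μ γ).V = fun r => r ^ 3 := funext (pureQuarticChain_deriv_V μ γ)
  rw [h]
  exact (Odd.strictMono_pow (by decide : Odd 3)).injective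

/-- **The only critical point of the purely quartic potential is the origin** (`μ > 0`):
`∂_iΦ(q) = 0` for all `i` forces `q = 0`, since `∑_i q_i ∂_iΦ(q) = μ∑ q_i⁴ + ∑_{bonds} Δ⁴`
(virial identity `OscillatorChain.sum_mul_dPotential`). [folklore] -/
theorem pureQuarticChain_eq_zero_of_dPotential_eq_zero {μ : ℝ} (hμ : 0 < μ) (γ : ℝ) (N : ℕ)
    (q : Fin N → ℝ) (h : ∀ i, (pureQuarticChain μ γ).dPotential N i q = 0) : q = 0 := by
  have hsum : ∑ i, q i * (pureQuarticChain μ γ).dPotential N i q = 0 := by simp [h]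
  rw [OscillatorChain.sum_mul_dPotential] at hsum
  simp only [pureQuarticChain_deriv_U, pureQuarticChain_deriv_V] at hsum
  have h1 : ∀ i, 0 ≤ q i * (μ * q i ^ 3) := fun i => by
    have : q i * (μ * q i ^ 3) = μ * q i ^ 4 := by ring
    rw [this]; positivity
  have h2 : 0 ≤ ∑ k : Fin N, ∑ l : Fin N,
      (if l.val = k.val + 1 then (q l - q k) ^ 3 * (q l - q k) else 0) := by
    refine Finset.sum_nonneg fun k _ => Finset.sum_nonneg fun l _ => ?_
    split_ifs
    · have : (q l - q k) ^ 3 * (q l - q k) = (q l - q k) ^ 4 := by ring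
      rw [this]; positivity
    · exact le_rfl
  have h3 : ∑ i, q i * (μ * q i ^ 3) = 0 :=
    le_antisymm (by linarith [Finset.sum_nonneg fun i (_ : i ∈ Finset.univ) => h1 i])
      (Finset.sum_nonneg fun i _ => h1 i)
  have h4 := (Finset.sum_eq_zero_iff_of_nonneg fun i _ => h1 i).1 h3
  funext i
  have hi := h4 i (Finset.mem_univ i)
  have : μ * q i ^ 4 = 0 := by rw [← hi]; ring
  have hq4 : q i ^ 4 = 0 := (mul_eq_zero.1 this).resolve_left hμ.ne'
  exact pow_eq_zero_iff (by norm_num : 4 ≠ 0) |>.1 hq4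

/-! ### The transition semigroup of the purely quartic chain -/

section Semigroup

variable {μ γ : ℝ} (hμ : 0 < μ) (hγ : 0 ≤ γ) (hN : 0 < N) {T_L T_R : ℝ} (hTL : 0 ≤ T_L) (hTR : 0 ≤ T_R)

/-! The transition semigroup of the Langevin-driven purely quartic chain (`μ > 0`, `γ ≥ 0`,
`N ≥ 1`, `T_L, T_R ≥ 0`) is `(pureQuarticChain_isConfining hμ hγ).semigroup N T_L T_R hN hTL hTR`:
the laws `P_t(x, ·) = law Φ_t(x, B)` of the global pathwise solutions of the SDE (2.2) (CEHR (2.3);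
p. 7: "the process admits strong solutions that are continuous and defined for all `t ≥ 0` … The
solutions to (3.1) form a Markov process whose generator `L` is given by (3.2)"), packaged as a
`LangevinChainSemigroup` by the model-free pipeline (`OscillatorChain.IsConfining.semigroup`, whose
kernels are `OscillatorChain.langevinKernel`). It is the witness of the existential fact
`CuneoEckmannHairerReyBellet2018_thm213_pureQuartic`; no abbreviation is introduced for it. -/

/-- **The Feller property** (CEHR p. 9: "the process is Feller"). [cite: CuneoEckmannHairerReyBellet2018, §3.3] -/
theorem pureQuarticChain_continuous_act_semigroup (t : ℝ≥0) (g : BoundedContinuousFunction (PhaseSpace N) ℝ) :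
    Continuous (((pureQuarticChain_isConfining hμ hγ).semigroup N T_L T_R hN hTL hTR).act t g) :=
  (pureQuarticChain_isConfining hμ hγ).continuous_act_semigroup N T_L T_R hN hTL hTR t g

include hμ hγ hN hTL hTR in
/-- **CEHR (3.4) for the purely quartic chain**: `E_z e^{θH(z_t)} ≤ e^{θγ(T_L+T_R)t} e^{θH(z)}`
for `0 < θ < 1/max(T_L, T_R)` (`T_L > 0`), from the generic
`LangevinChainSemigroup.lintegral_exp_mul_hamiltonian_le` (Dynkin + truncation + Gronwall + Fatou).
[cite: CuneoEckmannHairerReyBellet2018, §3 eq. (3.4)] -/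
theorem pureQuarticChain_lintegral_exp_mul_hamiltonian_kernel_le (hTL' : 0 < T_L)
    {θ : ℝ} (hθ : 0 < θ) (hθ' : θ < 1 / max T_L T_R) (t : ℝ≥0) (z : PhaseSpace N) :
    ∫⁻ y, ENNReal.ofReal (Real.exp (θ * (pureQuarticChain μ γ).hamiltonian N y))
        ∂((pureQuarticChain μ γ).langevinKernel N T_L T_R t z) ≤
      ENNReal.ofReal (Real.exp (θ * γ * (T_L + T_R) * t) *
        Real.exp (θ * (pureQuarticChain μ γ).hamiltonian N z)) := by
  have hm : 0 < max T_L T_R := lt_max_of_lt_left hTL'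
  have hθm : θ * max T_L T_R ≤ 1 := ((lt_div_iff₀ hm).1 hθ').le
  have hL : θ * T_L ≤ 1 := (mul_le_mul_of_nonneg_left (le_max_left _ _) hθ.le).trans hθm
  have hR : θ * T_R ≤ 1 := (mul_le_mul_of_nonneg_left (le_max_right _ _) hθ.le).trans hθm
  have h := ((pureQuarticChain_isConfining hμ hγ).semigroup N T_L T_R hN hTL hTR).lintegral_exp_mul_hamiltonian_le
    (pureQuarticChain_contDiff_U μ γ) (pureQuarticChain_contDiff_V μ γ) hN
    (by simpa using hγ) hTL hTR (pureQuarticChain_isCompact_setOf_hamiltonian_le hμ γ N) hθ.le hL hR t z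
  simpa only [pureQuarticChain_γ, IsConfining.semigroup_kernel] using h

/-- **Dynkin's identity on `C²_c`** for the semigroup (used for `C²` Lyapunov functions). [folklore] -/
theorem pureQuarticChain_semigroup_dynkin_two {f : PhaseSpace N → ℝ} (hf : ContDiff ℝ 2 f)
    (hf' : HasCompactSupport f) (t : ℝ≥0) (z : PhaseSpace N) :
    ((pureQuarticChain_isConfining hμ hγ).semigroup N T_L T_R hN hTL hTR).act t f z - f z =
      ∫ s in (0 : ℝ)..(t : ℝ), ((pureQuarticChain_isConfining hμ hγ).semigroup N T_L T_R hN hTL hTR).act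
        s.toNNReal ((pureQuarticChain μ γ).generator N T_L T_R f) z :=
  (pureQuarticChain_isConfining hμ hγ).semigroup_dynkin_two N T_L T_R hN hTL hTR hf hf' t z

end Semigroup

/-! ### LaSalle: relaxation of the undriven chain and irreducibility towards the equilibrium -/

section LaSalle

variable {μ γ : ℝ} (hμ : 0 < μ) (hγ : 0 < γ) (hN : 0 < N)
include hμ hγ hN

/-- **LaSalle for the damped purely quartic chain**: every trajectory of the undriven chain
(zero noise path) converges to `0` (`μ, γ > 0`, `N ≥ 1`) — `V' = r³` is injective and `0` is the
only critical point of `Φ`, so `OscillatorChain.IsConfining.tendsto_freeFlow_zero` applies.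
[cite: CuneoEckmannHairerReyBellet2018, Prop 3.3] -/
theorem pureQuarticChain_tendsto_freeFlow_zero (x : PhaseSpace N) :
    Tendsto (drivenFlow ((pureQuarticChain μ γ).drift N) x 0) atTop (𝓝 0) :=
  (pureQuarticChain_isConfining hμ hγ.le).tendsto_freeFlow_zero N (by simpa using hγ) hN
    (pureQuarticChain_deriv_V_injective μ γ) (pureQuarticChain_eq_zero_of_dPotential_eq_zero hμ γ N) x

/-- **Every neighbourhood of `0` is reached with positive probability at all large times** from
every initial condition (support theorem + LaSalle). [cite: CuneoEckmannHairerReyBellet2018, Prop 3.3] -/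
theorem pureQuarticChain_langevinKernel_pos_of_mem_nhds_zero (T_L T_R : ℝ) (z : PhaseSpace N)
    {G : Set (PhaseSpace N)} (hG : G ∈ 𝓝 (0 : PhaseSpace N)) :
    ∃ s₀ : ℝ≥0, ∀ t : ℝ≥0, s₀ ≤ t → 0 < (pureQuarticChain μ γ).langevinKernel N T_L T_R t z G :=
  (pureQuarticChain_isConfining hμ hγ.le).langevinKernel_pos_of_mem_nhds_zero N (by simpa using hγ) hN
    (pureQuarticChain_deriv_V_injective μ γ) (pureQuarticChain_eq_zero_of_dPotential_eq_zero hμ γ N)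
    T_L T_R z hG

/-- **Pointed irreducibility towards `0`** (the hypothesis `h_irred` of
`Literature/Probability/Process/SmallSets.lean`). [cite: CuneoEckmannHairerReyBellet2018, Prop 3.3] -/
theorem pureQuarticChain_exists_langevinKernel_pos_of_zero_mem (T_L T_R : ℝ) (z : PhaseSpace N)
    (U : Set (PhaseSpace N)) (hU : IsOpen U) (h0 : (0 : PhaseSpace N) ∈ U) :
    ∃ t : ℝ≥0, 0 < (pureQuarticChain μ γ).langevinKernel N T_L T_R t z U :=
  (pureQuarticChain_isConfining hμ hγ.le).exists_langevinKernel_pos_of_zero_mem N (by simpa using hγ)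
    hN (pureQuarticChain_deriv_V_injective μ γ) (pureQuarticChain_eq_zero_of_dPotential_eq_zero hμ γ N)
    T_L T_R z U hU h0

end LaSalle

end Literature.MathematicalPhysics.KineticTheory.HeatConduction

end
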